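import Mathlib.Data.Real.Basic
import Mathlib.Tactic.Ring
import Mathlib.Tactic.LinearCombination
import HarnessLib

/-!
# `NoHeavyLowerTail` (stmt-CriticalPhenomena-4575) — two identities placing the three-point cubic rows
# AG⁺ / SHK3⁺ of the new-inequality factory (E3GRP) against the literature

Support file (`--supports stmt-CriticalPhenomena-4575`, seat `prim-ineq-prove-4` gen 2).  Pure algebra on
the five-point law `(t, q, u₀, u₁, u₂)` of the partition of three terminals `a, b, c` by connectivity
(`t = P(abc)`, `q = P(a|b|c)`, `u₀ = P(a|bc)`, `u₁ = P(b|ac)`, `u₂ = P(c|ab)`, `t + q + u₀ + u₁ + u₂ = 1`).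

* `sahiE3_pairwiseDisconnection_eq` — the factory row SHK3⁺, `(1+t)(tq − e₂(u)) − e₃(u)`, IS the
  Richards–Sahi third "conjugate cumulant" `E₃(f,g,h) = 2E(fgh) − Σ_cyc E(f)E(gh) + E f·E g·E h` of the
  indicators of the three pairwise DISCONNECTION events `{b↮c}, {a↮c}, {a↮b}` (probabilities
  `q+u₁+u₂, q+u₀+u₂, q+u₀+u₁`; pairwise intersections `q+u₂, q+u₁, q+u₀`; triple intersection `q`).
  `E₃ ≥ 0` for monotone functions on an FKG lattice is Sahi's Conjecture 5 (Combinatorica 28 (2008)) =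
  Richards' `κ′₃ ≥ 0` (2004, proof with gaps); per Lieb–Sahi (J. Math. Phys. 63 (2022), §1) and Gladkov
  (arXiv:2408.08457, Rem. 8.8) it is OPEN even for indicators of monotone events under product measure on
  `{0,1}^k`.  So SHK3⁺ is that conjecture restricted to co-sunflower triples, and AG⁺ = SHK3⁺ − t·AG is stronger.
* `mul_agPlus_eq` — the connection form of AG⁺: `t·(tq − e₂ − e₃) = t² − τ_bc τ_ac τ_ab + (1−t)·u₀u₁u₂`
  with `τ = t + u` the pairwise connection probabilities.

Evidence recorded on the item (file `EGC-REFUTED.md`, 2026-08-19): for the hexagon `C₆` with terminals at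
alternating vertices and `p = 1/3`, AG⁺, SHK3⁺ and Hqt all violate deletion–contraction convexity
`F(G) ≥ (1−p)F(G∖e) + pF(G/e)` at EVERY edge (exact rationals), so no Harris–Kleitman-style one-coordinate
induction proves any of them; the hypothesis `hgood` of `SunflowerCubic.core` is unsatisfiable for `|ι| ≥ 6`.
No definitions, no named facts, no sorries.
-/

namespace Summit.CriticalPhenomena.PercolationContinuityZ3.Theorems

namespace ThreePointCubic

/-- **SHK3⁺ is Sahi's `E₃` of the three pairwise-disconnection events.**  With `t+q+u₀+u₁+u₂ = 1`,
writing `dX = q+u₁+u₂`, `dY = q+u₀+u₂`, `dZ = q+u₀+u₁` for the probabilities of `{b↮c}, {a↮c}, {a↮b}`,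
`q+u₂, q+u₁, q+u₀` for their pairwise intersections and `q` for the triple intersection,
`2q − (dX(q+u₀) + dY(q+u₁) + dZ(q+u₂)) + dX·dY·dZ = (1+t)(tq − e₂(u)) − e₃(u)`. -/
theorem sahiE3_pairwiseDisconnection_eq (t q u₀ u₁ u₂ : ℝ) (h : t + q + u₀ + u₁ + u₂ = 1) :
    2 * q - ((q + u₁ + u₂) * (q + u₀) + (q + u₀ + u₂) * (q + u₁) + (q + u₀ + u₁) * (q + u₂)) +
        (q + u₁ + u₂) * (q + u₀ + u₂) * (q + u₀ + u₁) =
      (1 + t) * (t * q - (u₀ * u₁ + u₀ * u₂ + u₁ * u₂)) - u₀ * u₁ * u₂ := by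
  have hq : q = 1 - t - u₀ - u₁ - u₂ := by linear_combination h
  subst hq
  ring

/-- **Connection form of AG⁺.**  With `t+q+u₀+u₁+u₂ = 1` and `τ_i = t + u_i` the pairwise connection
probabilities, `t·(tq − e₂(u) − e₃(u)) = t² − τ₀τ₁τ₂ + (1 − t)·u₀u₁u₂`; in particular (for `t > 0`) AG⁺ reads
`τ_bc τ_ac τ_ab ≤ P(abc)² + (1 − P(abc))·u₀u₁u₂`, and Gladkov's AG reads `τ_bc τ_ac τ_ab ≤ P(abc)² + u₀u₁u₂`. -/
theorem mul_agPlus_eq (t q u₀ u₁ u₂ : ℝ) (h : t + q + u₀ + u₁ + u₂ = 1) :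
    t * (t * q - (u₀ * u₁ + u₀ * u₂ + u₁ * u₂) - u₀ * u₁ * u₂) =
      t ^ 2 - (t + u₀) * (t + u₁) * (t + u₂) + (1 - t) * (u₀ * u₁ * u₂) := by
  have hq : q = 1 - t - u₀ - u₁ - u₂ := by linear_combination h
  subst hq
  ring

/-- **AG in connection form** (same substitution): `t·(tq − e₂(u)) = t² − τ₀τ₁τ₂ + u₀u₁u₂`. -/
theorem mul_ag_eq (t q u₀ u₁ u₂ : ℝ) (h : t + q + u₀ + u₁ + u₂ = 1) :
    t * (t * q - (u₀ * u₁ + u₀ * u₂ + u₁ * u₂)) =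
      t ^ 2 - (t + u₀) * (t + u₁) * (t + u₂) + u₀ * u₁ * u₂ := by
  have hq : q = 1 - t - u₀ - u₁ - u₂ := by linear_combination h
  subst hq
  ring

end ThreePointCubic

end Summit.CriticalPhenomena.PercolationContinuityZ3.Theorems
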